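import Summits.ResolutionOfSingularities.ResolutionOfSingularities.Theorems.DescentDescentPerfectToAllLevelResolution
import Summits.ResolutionOfSingularities.ResolutionOfSingularities.Theorems.DescentDescentPerfectToAllFgModel
import Summits.ResolutionOfSingularities.ResolutionOfSingularities.Theorems.DescentDescentPerfectToAllRobustModel
import Summits.ResolutionOfSingularities.ResolutionOfSingularities.Theorems.WeightedInvariantDescentReducedToIntegral
import Literature.AlgebraicGeometry.Resolution.SmoothOfRegularPerfectField
import Literature.AlgebraicGeometry.Resolution.SmoothStalksRegular
import Mathlib.FieldTheory.PurelyInseparable.PerfectClosure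
import Mathlib.FieldTheory.IsPerfectClosure
import HarnessLib

/-!
# Crux `PrimeFieldToPerfect` (stmt-ResolutionOfSingularities-15233), line `birth`: stub `stub_spreadOut`

Route `ResolutionOfSingularities/UniversalCells`, crux `PrimeFieldToPerfect`: resolution of all
integral separated finite-type schemes over the prime field `𝔽_p = ZMod p` implies resolution of
all reduced separated finite-type schemes over every perfect field of characteristic `p`. The
lead's skeleton cuts this as prime field ⇒ finitely generated fields (THIS stub) ⇒ smooth
twisted models ⇒ perfect closures ⇒ all perfect fields.

**Statement (`stub_spreadOut`: spreading out + generic fibre).** Let `p` be a prime and assume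
that every integral separated scheme of finite type over `Spec (ZMod p)` admits a resolution of
singularities. Let `K` be a field of characteristic `p` which is finitely generated as a field
(`Subfield.closure s = ⊤` for a finite set `s`) and `f : X → Spec K` separated, locally of finite
type and quasi-compact with `X` integral. Then `X` admits a resolution of singularities.

**Proof.**
* Reduced ⇒ integral over the fixed field `ZMod p` (`Theorems.descentReducedToIntegral_proof`):
  the hypothesis upgrades to all *reduced* separated finite-type `ZMod p`-schemes.
* `levelResolution_of_primeField` (the proof of `Theorems.stub_levelResolution`, whose hypothesis
  is only ever used over the prime field `κ = ZMod p`): for a subfield `L = closure t` of a field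
  `k` of characteristic `p` generated by a finite set `t` and `g : Z → Spec L` separated of finite
  type with `Z` reduced, spread `Z` out (`exists_finiteTypeModel`,
  `exists_isPullback_toImage_of_isLocallyNoetherian`) to a reduced model `Z_R → Spec R` of finite
  type over a finitely generated `𝔽_p`-subalgebra `R ⊆ L` with `Frac R = L`
  (`Subfield.mem_closure_iff`); resolve `Z_R` as an `𝔽_p`-scheme; the generic fibre of that
  resolution resolves `Z ≅ Z_R ×_R Spec L` (`hasResolution_pullback_of_flat_of_surjectiveOnStalks`;
  `Spec L → Spec R` is a flat preimmersion). No field extension occurs, so no regular-versus-smooth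
  issue arises.
* Instantiate with `k := K`, `L := ⊤ = closure s`, `Z := X` and `g := f ≫ Spec (⊤ ≃+* K)`, the
  composition of `f` with an isomorphism.

Sources: [cite: EGAIV3, Thm. 8.8.2 (ii)] (spreading out finitely presented schemes and their
morphisms over a filtered limit of rings; 8.10.5 for the descent of the properties used);
the reduction of resolution of singularities to finitely generated ground fields is folklore
(Kollár 2007, Ch. 3).
-/

noncomputable section

set_option linter.dupNamespace false -- mandated namespace of this single-conjunct summit

open CategoryTheory CategoryTheory.Limits AlgebraicGeometry MonoidalCategory Opposite
open TopologicalSpace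
open Literature.AlgebraicGeometry.Limits Literature.AlgebraicGeometry.Morphisms
open Literature.AlgebraicGeometry.Resolution
open Literature.AlgebraicGeometry.Motives (SchemeOver specOver)

namespace Summit.ResolutionOfSingularities.ResolutionOfSingularities.Theorems.PrimeFieldToPerfect

-- As in `Literature/AlgebraicGeometry/Limits/SubalgebraDiagram.lean` and `ClosedSubschemes.lean`:
-- the cone legs `c.π.app i` have source `((Functor.const _).obj c.pt).obj i`, definitionally `c.pt`.
set_option backward.isDefEq.respectTransparency false

universe u

/-- **Resolution over the prime field `𝔽_p` ⇒ resolution over finitely generated fields of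
characteristic `p`** (the proof of `Theorems.stub_levelResolution`, with its hypothesis
restricted to the prime field, the only level at which that proof invokes it): if every reduced
separated scheme of finite type over `Spec (ZMod p)` admits a resolution, then so does every
reduced separated scheme of finite type over a subfield `L = closure t` of a field `k` of
characteristic `p` generated by a finite set `t` — spread `Z` out to a reduced model over a
finitely generated `𝔽_p`-algebra `R ⊆ L` with `Frac R = L`, resolve the model as an
`𝔽_p`-scheme, and pass to the generic fibre. [cite: EGAIV3, Thm. 8.8.2 (ii)] -/
theorem levelResolution_of_primeField (p : ℕ) [Fact p.Prime]
    (H0 : ∀ (Z : Scheme.{0}) (g : Z ⟶ Spec (.of (ZMod p))), IsSeparated g →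
      LocallyOfFiniteType g → QuasiCompact g → IsReduced Z → Scheme.HasResolution Z)
    (k : Type) [Field k] [CharP k p] (L : Subfield k) (t : Finset k)
    (hL : L = Subfield.closure (↑t : Set k)) (Z : Scheme.{0}) (g : Z ⟶ Spec (.of L))
    [IsSeparated g] [LocallyOfFiniteType g] [QuasiCompact g] [IsReduced Z] :
    Scheme.HasResolution Z := by
  -- adapted from Theorems/DescentDescentPerfectToAllLevelResolution.lean (stub_levelResolution)
  classical
  -- ### Step 1: a closed `L`-immersion into a finite type model over a finitely generated subring
  obtain ⟨A₀, _, φ, Y₀, p₀, j, hNoeth, hfgA, -, hpsep, hplft, hpqc, hj, hjg⟩ :=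
    exists_finiteTypeModel g
  letI : Algebra A₀ L := φ.toAlgebra
  haveI := hNoeth
  let P : SchemeOver A₀ := Over.mk p₀
  haveI : IsSeparated P.hom := hpsep
  haveI : QuasiCompact P.hom := hpqc
  haveI : LocallyOfFiniteType P.hom := hplft
  let jY : Z ⟶ (P ⊗ specOver A₀ L).left := j
  haveI : IsClosedImmersion jY := hj
  have hg : jY ≫ pullback.snd P.hom (specOver A₀ L).hom = g := hjg
  -- the finite generating set `t`, seen inside `L`
  let tL : Finset L := t.subtype (· ∈ L)
  -- ### Step 2: the closed subscheme `Z` descends to a stage `R = A₀[t'] ⊆ L`, `t ⊆ t'`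
  haveI : IsLocallyNoetherian (SubalgApprox.prodCone A₀ L tL P).pt := by
    haveI : IsLocallyNoetherian (specOver A₀ L).left :=
      inferInstanceAs (IsLocallyNoetherian (Spec (.of L)))
    change IsLocallyNoetherian (pullback P.hom (specOver A₀ L).hom)
    exact LocallyOfFiniteType.isLocallyNoetherian (pullback.snd P.hom (specOver A₀ L).hom)
  obtain ⟨i, hi⟩ := exists_isPullback_toImage_of_isLocallyNoetherian
    (SubalgApprox.prodDiagram A₀ L tL P) (SubalgApprox.prodCone A₀ L tL P)
    (SubalgApprox.isLimitProdCone A₀ L tL P) jY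
  have HX := hi i (𝟙 i)
  let R : Subalgebra A₀ L := SubalgApprox.sub A₀ L i.unop.1
  let π : (P ⊗ specOver A₀ L).left ⟶ (SubalgApprox.prodDiagram A₀ L tL P).obj i :=
    (SubalgApprox.prodCone A₀ L tL P).π.app i
  have Hleg : IsPullback π (pullback.snd P.hom (specOver A₀ L).hom)
      (pullback.snd P.hom (specOver A₀ R).hom)
      (Spec.map (CommRingCat.ofHom (algebraMap R L))) :=
    SubalgApprox.isPullback_whiskerLeft_left P ((SubalgApprox.baseCone A₀ L tL).π.app i)
  let Xt : Scheme.{0} := (jY ≫ π).image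
  let πt : Z ⟶ Xt := (jY ≫ π).toImage
  let ft : Xt ⟶ Spec (.of R) := (jY ≫ π).imageι ≫ pullback.snd P.hom (specOver A₀ R).hom
  let s : Spec (.of L) ⟶ Spec (.of R) := Spec.map (CommRingCat.ofHom (algebraMap R L))
  have Hmain : IsPullback πt g ft s := by
    have h := HX.flip.paste_vert Hleg
    rwa [hg] at h
  -- `Z_R = Xt` is reduced, and separated of finite type over `R`
  haveI : IsReduced Xt := ChowLemmaProof.isReduced_image (jY ≫ π)
  haveI : IsSeparated ft := inferInstance
  haveI : LocallyOfFiniteType ft := inferInstance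
  haveI : QuasiCompact ft := inferInstance
  -- ### Step 3: `R` is of finite type over the prime field `𝔽_p`; resolve `Z_R` over `𝔽_p`
  have hinj : Function.Injective (algebraMap R L) := fun x y hxy => Subtype.ext hxy
  haveI : CharP R p := (algebraMap R L).charP hinj p
  let ψ : ZMod p →+* R := ZMod.castHom (dvd_refl p) R
  have hψ : ψ.FiniteType := by
    have h1 : Algebra.FiniteType ℤ R := hfgA.trans inferInstance
    have h2 : (algebraMap ℤ R).FiniteType := RingHom.finiteType_algebraMap.mpr h1
    have h3 : algebraMap ℤ R = ψ.comp (Int.castRingHom (ZMod p)) := RingHom.ext_int _ _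
    rw [h3] at h2
    exact RingHom.FiniteType.of_comp_finiteType h2
  let b : Spec (.of R) ⟶ Spec (.of (ZMod p)) := Spec.map (CommRingCat.ofHom ψ)
  haveI : LocallyOfFiniteType b := by
    rw [HasRingHomProperty.Spec_iff (P := @LocallyOfFiniteType)]
    exact hψ
  haveI : IsSeparated (ft ≫ b) := inferInstance
  haveI : LocallyOfFiniteType (ft ≫ b) := inferInstance
  haveI : QuasiCompact (ft ≫ b) := inferInstance
  obtain ⟨Y, πr, hres⟩ := H0 Xt (ft ≫ b) inferInstance inferInstance inferInstance inferInstance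
  -- ### Step 4: `L = Frac R`, so `Spec L → Spec R` is a flat preimmersion
  have htR : ∀ x ∈ t, ∃ hx : x ∈ L, (⟨x, hx⟩ : L) ∈ R := fun x hx => by
    have hxL : x ∈ L := by
      rw [hL]
      exact Subfield.subset_closure (Finset.mem_coe.2 hx)
    exact ⟨hxL, Algebra.subset_adjoin (Finset.mem_coe.2 (i.unop.2 (Finset.mem_subtype.2 hx)))⟩
  have hsurj : ∀ z : L, ∃ x y : R, z = algebraMap R L x / algebraMap R L y := by
    intro z
    have hz : (z : k) ∈ Subfield.closure (↑t : Set k) := by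
      rw [← hL]
      exact z.2
    obtain ⟨y, hy, w, hw, hyw⟩ := Subfield.mem_closure_iff.mp hz
    have hle : Subring.closure (↑t : Set k) ≤ R.toSubring.map L.subtype :=
      Subring.closure_le.mpr fun x hx => by
        obtain ⟨hxL, hxR⟩ := htR x (Finset.mem_coe.1 hx)
        exact ⟨⟨x, hxL⟩, hxR, rfl⟩
    obtain ⟨r, hr, rfl⟩ := hle hy
    obtain ⟨r', hr', rfl⟩ := hle hw
    refine ⟨⟨r, hr⟩, ⟨r', hr'⟩, Subtype.ext ?_⟩
    change (z : k) = (((r / r' : L)) : k)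
    rw [Subfield.coe_div]
    exact hyw.symm
  haveI : FaithfulSMul R L := (faithfulSMul_iff_algebraMap_injective R L).mpr hinj
  haveI : IsFractionRing R L := IsFractionRing.of_field R L hsurj
  haveI : IsPreimmersion s := IsPreimmersion.of_isLocalization (nonZeroDivisors R)
  haveI : Flat s := by
    rw [Flat.SpecMap_iff, CommRingCat.hom_ofHom]
    exact RingHom.flat_algebraMap_iff.mpr (IsLocalization.flat L (nonZeroDivisors R))
  -- ### Step 5: the generic fibre of the resolution of `Z_R` resolves `Z ≅ Z_R ×_R Spec L`
  haveI := hres.isProper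
  haveI : IsNoetherian Xt := Scheme.isNoetherian_of_finiteType_over_field (ft ≫ b)
  haveI : IsNoetherian Y := Scheme.isNoetherian_of_finiteType_over_field (πr ≫ ft ≫ b)
  exact (hasResolution_pullback_of_flat_of_surjectiveOnStalks ft s πr hres).of_iso
    Hmain.isoPullback.inv

/-- **Spreading out + generic fibre** (stub `stub_spreadOut` of crux `PrimeFieldToPerfect`): if
every integral separated scheme of finite type over `Spec (ZMod p)` (`p` prime) admits a
resolution of singularities, then so does every integral separated scheme of finite type
`X → Spec K` over a field `K` of characteristic `p` which is finitely generated as a field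
(`Subfield.closure s = ⊤` for a finite `s`). Proof: upgrade the hypothesis to reduced
`ZMod p`-schemes (`Theorems.descentReducedToIntegral_proof`), then apply
`levelResolution_of_primeField` to `L = ⊤ = closure s ⊆ K` and `X → Spec K ≅ Spec ⊤`: `X` is the
generic fibre of a reduced finite-type model over a finitely generated `𝔽_p`-algebra `R` with
`Frac R = K`, and the generic fibre of a resolution of that model resolves `X`.
[cite: EGAIV3, Thm. 8.8.2 (ii)] -/
theorem stub_spreadOut (p : ℕ) (hp : p.Prime) (h : ∀ (X : Scheme.{0}) (f : X ⟶ Spec (.of (ZMod p))), IsSeparated f → LocallyOfFiniteType f → QuasiCompact f → IsIntegral X → Scheme.HasResolution X) (K : Type) [Field K] [CharP K p] (hK : ∃ s : Finset K, Subfield.closure (s : Set K) = ⊤) (X : Scheme.{0}) (f : X ⟶ Spec (.of K)) (hs : IsSeparated f) (hl : LocallyOfFiniteType f) (hq : QuasiCompact f) (hX : IsIntegral X) : Scheme.HasResolution X := by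
  haveI : Fact p.Prime := ⟨hp⟩
  obtain ⟨s, hsK⟩ := hK
  -- reduced ⇒ integral over the fixed field `ZMod p`
  have H0 : ∀ (Z : Scheme.{0}) (g : Z ⟶ Spec (.of (ZMod p))), IsSeparated g →
      LocallyOfFiniteType g → QuasiCompact g → IsReduced Z → Scheme.HasResolution Z :=
    descentReducedToIntegral_proof (ZMod p) h
  -- `K = ⊤ = closure s`, and `Spec K ≅ Spec ↥(⊤ : Subfield K)`
  let e : (⊤ : Subfield K) ≃+* K := Subfield.topEquiv
  let ι : Spec (.of K) ⟶ Spec (.of (⊤ : Subfield K)) := Spec.map (CommRingCat.ofHom e.toRingHom)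
  haveI : IsIso ι := inferInstanceAs (IsIso (Spec.map e.toCommRingCatIso.hom))
  exact levelResolution_of_primeField p H0 K ⊤ s hsK.symm X (f ≫ ι)

end Summit.ResolutionOfSingularities.ResolutionOfSingularities.Theorems.PrimeFieldToPerfect

end
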